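import Summits.HubbardSuperconductivity.HubbardSuperconductivity.Theses.ThermalWedge
import Literature.MathematicalPhysics.QuantumLattice.DWaveSourceFreeGainBound
import Literature.MathematicalPhysics.QuantumLattice.TorusCooperSum
import Summits.HubbardSuperconductivity.HubbardSuperconductivity.Theorems.ThermalWedgeTwSourcedInertnessReduction

/-!
# Crux `TwSourcedCondensation` (item `stmt-HubbardSuperconductivity-1697`): no finite-size threshold can be
chosen before the temperature (unconditional)

Standing disprover, generation 3 (`--supports`); no definition introduced. Sequel to
`FrozenThresholdFreeGap` (which needed a free-cluster gap HYPOTHESIS); the tree now PROVES the exact BdG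
pressure of the `d`-wave-sourced free torus (`Literature…DWaveSourceFreePressure`,
`log_partitionFn_dWaveSourceTorus_zero_sub`, `L ≥ 3`) and the per-mode gain bound
(`Literature…BdGModeGainBound.bdgModeGain_le`), which make the frozen/uniform-threshold obstruction
hypothesis-free:

* `free_logGain_le_of_levelGap`, `free_gain_le_of_levelGap` — on a torus (`L ≥ 3`) whose free levels
  `ε_L(k)` avoid `μ` by `γ > 0`, the FREE sourced response is capped UNIFORMLY IN `β`:
  `p̃₀(β,h) - p̃₀(β,0) ≤ 32h²/γ` (per mode `≤ βD²·β/(2+β|ξ|) ≤ 32βh²/γ`);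
* `gain_le_of_levelGap` — hence `p̃_U(β,h) - p̃_U(β,0) ≤ 32h²/γ + 2|U|` (tree `sourcedGain_le_free_add`);
* `exists_mu_off_levels` — generic `μ` in a nondegenerate interval is off the finite level set;
* `levelGap_obstruction` — TIGHTNESS FORM: where the crux's inequality (constants `c, C`) holds at the
  admissible point `β = 1/U`, `h = √U`, the torus must have `c(½ log(1/U) - log 2) - C ≤ 32/γ + 2`, i.e. a
  free level within `O(1/(c log β))` of `μ`;
* `twSourcedCondensation_false_uniformL0` — the crux with `∃ L₀` in front of `∀ U β μ` is FALSE;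
  `twSourcedCondensation_false_frozenThreshold ℓ` — so is the threshold frozen at any side `ℓ`.

MESSAGE TO PROVERS: `L₀(U, β, μ)` is load-bearing and must grow with `β` at every generic `μ`
(quantitatively `≳ √(c log β)` from this crude argument; the physical scale is the thermal length `L ≳ β`).
Tree: `log_partitionFn_dWaveSourceTorus_zero_sub`, `bdgModeGain_le`, `abs_dWaveGap_le_two`,
`card_torusSite_two`, `sourcedGain_le_free_add`, `Set.Icc_infinite`.
-/

noncomputable section

namespace Summit.HubbardSuperconductivity.HubbardSuperconductivity.Theorems.TwSourcedCondensation.Negative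

open Matrix Finset Literature.MathematicalPhysics.QuantumLattice Literature.Probability.LatticeModels
open Summit.HubbardSuperconductivity.HubbardSuperconductivity.Theorems
open scoped Matrix.Norms.L2Operator ComplexOrder

/-- `(2√2 h ĝ_d(k))² ≤ 32 h²`. [folklore] -/
theorem bdg_pairing_sq_le {L : ℕ} (h : ℝ) (k : TorusSite 2 L) :
    (2 * Real.sqrt 2 * h * dWaveGap k) ^ 2 ≤ 32 * h ^ 2 := by
  have h2 : Real.sqrt 2 ^ 2 = 2 := Real.sq_sqrt zero_le_two
  have hg : (dWaveGap k) ^ 2 ≤ 4 := by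
    have h1 := abs_dWaveGap_le_two k
    have h0 := abs_nonneg (dWaveGap k)
    rw [← sq_abs]
    nlinarith
  have h8 : 0 ≤ 8 * h ^ 2 := by positivity
  calc (2 * Real.sqrt 2 * h * dWaveGap k) ^ 2 = 8 * h ^ 2 * (dWaveGap k) ^ 2 := by
        rw [mul_pow, mul_pow, mul_pow, h2]; ring
    _ ≤ 8 * h ^ 2 * 4 := mul_le_mul_of_nonneg_left hg h8
    _ = 32 * h ^ 2 := by ring

/-- **Free gain of a torus whose levels avoid `μ` by `γ`** (numerator form, `L ≥ 3`, `β > 0`): from the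
exact BdG formula (`log_partitionFn_dWaveSourceTorus_zero_sub`) and the per-mode bound
`bdgModeGain_le` (`≤ βD²·β/(2+β|ξ|) ≤ βD²/γ`):
`log Z_β(H_L(0,μ,h)) - log Z_β(H_L(0,μ,0)) ≤ L² · 32βh²/γ`. [folklore] -/
theorem free_logGain_le_of_levelGap {L : ℕ} [NeZero L] (hL : 3 ≤ L) {μ γ : ℝ} (hγ : 0 < γ)
    (hgap : ∀ k : TorusSite 2 L, γ ≤ |torusBand L k - μ|) {β : ℝ} (hβ : 0 < β) (h : ℝ) :
    Real.log (partitionFn β (dWaveSourceTorus L 0 μ h)).re -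
        Real.log (partitionFn β (dWaveSourceTorus L 0 μ 0)).re ≤
      (L : ℝ) ^ 2 * (32 * β * h ^ 2 / γ) := by
  rw [log_partitionFn_dWaveSourceTorus_zero_sub hL β μ h]
  have hmode : ∀ k : TorusSite 2 L,
      Real.log ((1 + Real.cosh (β * Real.sqrt ((torusBand L k - μ) ^ 2 +
          (2 * Real.sqrt 2 * h * dWaveGap k) ^ 2))) / 2) -
        Real.log ((1 + Real.cosh (β * (torusBand L k - μ))) / 2) ≤ 32 * β * h ^ 2 / γ := by
    intro k
    refine (bdgModeGain_le hβ (torusBand L k - μ) (2 * Real.sqrt 2 * h * dWaveGap k)).trans ?_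
    have hD := bdg_pairing_sq_le h k
    have hfrac : β / (2 + β * |torusBand L k - μ|) ≤ 1 / γ := by
      have hden : 0 < 2 + β * |torusBand L k - μ| := by positivity
      rw [div_le_div_iff₀ hden hγ, one_mul]
      have := mul_le_mul_of_nonneg_left (hgap k) hβ.le
      linarith
    have hfrac0 : 0 ≤ β / (2 + β * |torusBand L k - μ|) := by positivity
    calc β * (2 * Real.sqrt 2 * h * dWaveGap k) ^ 2 * (β / (2 + β * |torusBand L k - μ|))
        ≤ β * (32 * h ^ 2) * (1 / γ) :=
          mul_le_mul (mul_le_mul_of_nonneg_left hD hβ.le) hfrac hfrac0 (by positivity)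
      _ = 32 * β * h ^ 2 / γ := by ring
  calc ∑ k : TorusSite 2 L, (Real.log ((1 + Real.cosh (β * Real.sqrt ((torusBand L k - μ) ^ 2 +
          (2 * Real.sqrt 2 * h * dWaveGap k) ^ 2))) / 2) -
        Real.log ((1 + Real.cosh (β * (torusBand L k - μ))) / 2))
      ≤ ∑ _k : TorusSite 2 L, 32 * β * h ^ 2 / γ := Finset.sum_le_sum fun k _ => hmode k
    _ = (L : ℝ) ^ 2 * (32 * β * h ^ 2 / γ) := by
        rw [Finset.sum_const, Finset.card_univ, card_torusSite_two, nsmul_eq_mul]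
        push_cast
        ring

/-- **`β`-UNIFORM cap on the free response of a torus whose levels avoid `μ`**:
`p̃_L(β,0,μ,h) - p̃_L(β,0,μ,0) ≤ 32h²/γ` for all `β > 0`, all real `h`. [folklore] -/
theorem free_gain_le_of_levelGap {L : ℕ} [NeZero L] (hL : 3 ≤ L) {μ γ : ℝ} (hγ : 0 < γ)
    (hgap : ∀ k : TorusSite 2 L, γ ≤ |torusBand L k - μ|) {β : ℝ} (hβ : 0 < β) (h : ℝ) :
    (Real.log (partitionFn β (dWaveSourceTorus L 0 μ h)).re / (β * (L : ℝ) ^ 2)) - (Real.log (partitionFn β (dWaveSourceTorus L 0 μ 0)).re / (β * (L : ℝ) ^ 2)) ≤ 32 * h ^ 2 / γ := by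
  have hL2 : (0 : ℝ) < (L : ℝ) ^ 2 := cast_sq_pos_of_neZero L
  have hden : 0 < β * (L : ℝ) ^ 2 := mul_pos hβ hL2
  rw [← sub_div, div_le_iff₀ hden]
  refine (free_logGain_le_of_levelGap hL hγ hgap hβ h).trans (le_of_eq ?_)
  field_simp

/-- **The interacting response of such a torus is capped `β`-uniformly up to `2U`**:
`p̃_L(β,U,μ,h) - p̃_L(β,U,μ,0) ≤ 32h²/γ + 2|U|` (`G_U ≤ G_0 + 2|U|`, tree
`sourcedGain_le_free_add`). [folklore] -/
theorem gain_le_of_levelGap {L : ℕ} [NeZero L] (hL : 3 ≤ L) {μ γ : ℝ} (hγ : 0 < γ)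
    (hgap : ∀ k : TorusSite 2 L, γ ≤ |torusBand L k - μ|) {β : ℝ} (hβ : 0 < β) (U h : ℝ) :
    (Real.log (partitionFn β (dWaveSourceTorus L U μ h)).re / (β * (L : ℝ) ^ 2)) - (Real.log (partitionFn β (dWaveSourceTorus L U μ 0)).re / (β * (L : ℝ) ^ 2)) ≤ 32 * h ^ 2 / γ + 2 * |U| := by
  have h1 := Summit.HubbardSuperconductivity.HubbardSuperconductivity.Theorems.sourcedGain_le_free_add L U μ h hβ
  have h2 := free_gain_le_of_levelGap hL hγ hgap hβ h
  linarith

/-- **Generic chemical potentials are off the finite level set**: in any nondegenerate interval there is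
`μ` at positive distance `γ` from every free level `ε_L(k)` of the `L`-torus. [folklore] -/
theorem exists_mu_off_levels (L : ℕ) [NeZero L] {μ₁ μ₂ : ℝ} (h12 : μ₁ < μ₂) :
    ∃ μ ∈ Set.Icc μ₁ μ₂, ∃ γ : ℝ, 0 < γ ∧ ∀ k : TorusSite 2 L, γ ≤ |torusBand L k - μ| := by
  classical
  obtain ⟨μ, hμ, hnot⟩ := (Set.Icc_infinite h12).exists_notMem_finset
    (Finset.univ.image fun k : TorusSite 2 L => torusBand L k)
  obtain ⟨k₀, -, hk₀⟩ := Finset.exists_min_image Finset.univ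
    (fun k : TorusSite 2 L => |torusBand L k - μ|) ⟨fun _ => 0, Finset.mem_univ _⟩
  refine ⟨μ, hμ, |torusBand L k₀ - μ|, ?_, fun k => hk₀ k (Finset.mem_univ k)⟩
  have hne : torusBand L k₀ ≠ μ := fun heq =>
    hnot (Finset.mem_image.2 ⟨k₀, Finset.mem_univ _, heq⟩)
  exact abs_pos.2 (sub_ne_zero.2 hne)

/-- **Tightness form of the obstruction.** If the free levels of the `L`-torus (`L ≥ 3`) avoid `μ` by
`γ > 0`, and the crux's inequality with constants `c > 0`, `C` holds at that `(μ, L)` for the admissible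
point `β = 1/U`, `h = √U` (`0 < U ≤ 1`), then `c(½ log(1/U) - log 2) - C ≤ 32/γ + 2`: the torus must
carry a free level within `O(1/(c log β))` of `μ`, i.e. `L₀(U,β,μ)` is forced to grow with `log β`.
[folklore] -/
theorem levelGap_obstruction {L : ℕ} [NeZero L] (hL : 3 ≤ L) {μ γ : ℝ} (hγ : 0 < γ)
    (hgap : ∀ k : TorusSite 2 L, γ ≤ |torusBand L k - μ|) {U c C : ℝ} (hU : 0 < U) (hU1 : U ≤ 1)
    (hc : 0 < c)
    (hineq : c * Real.sqrt U ^ 2 * Real.log (1 / (|Real.sqrt U| + 1 / (1 / U))) - C * Real.sqrt U ^ 2 ≤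
      (Real.log (partitionFn (1 / U) (dWaveSourceTorus L U μ (Real.sqrt U))).re / ((1 / U) * (L : ℝ) ^ 2)) - (Real.log (partitionFn (1 / U) (dWaveSourceTorus L U μ 0)).re / ((1 / U) * (L : ℝ) ^ 2))) :
    c * (Real.log (1 / U) / 2 - Real.log 2) - C ≤ 32 / γ + 2 := by
  set h : ℝ := Real.sqrt U with hh
  have hhpos : 0 < h := Real.sqrt_pos.2 hU
  have hh2 : h ^ 2 = U := Real.sq_sqrt hU.le
  have hhle1 : h ≤ 1 := by rw [hh, ← Real.sqrt_one]; exact Real.sqrt_le_sqrt hU1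
  have hβpos : 0 < 1 / U := one_div_pos.2 hU
  -- the cap at `β = 1/U`: `(32/γ) h² + 2U = (32/γ + 2) h²`
  have hcap := gain_le_of_levelGap hL hγ hgap hβpos U h
  rw [abs_of_pos hU] at hcap
  -- the floor: `log(1/(h + h²)) ≥ ½ log(1/U) - log 2`
  have hlog : Real.log (1 / U) / 2 - Real.log 2 ≤ Real.log (1 / (|h| + 1 / (1 / U))) := by
    rw [abs_of_pos hhpos, one_div_one_div, ← hh2]
    have hsq' : h ^ 2 ≤ h := by rw [sq]; exact mul_le_of_le_one_left hhpos.le hhle1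
    have hsum' : h + h ^ 2 ≤ 2 * h := by linarith
    have hpos' : 0 < h + h ^ 2 := by positivity
    have hlogh : Real.log h = -(Real.log (1 / h ^ 2) / 2) := by
      rw [one_div, Real.log_inv, Real.log_pow]; push_cast; ring
    calc Real.log (1 / h ^ 2) / 2 - Real.log 2 = Real.log (1 / (2 * h)) := by
          rw [one_div (2 * h), Real.log_inv, Real.log_mul two_ne_zero hhpos.ne', hlogh]; ring
      _ ≤ Real.log (1 / (h + h ^ 2)) :=
          Real.log_le_log (by positivity) (one_div_le_one_div_of_le hpos' hsum')
  have hh2pos : 0 < h ^ 2 := by positivity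
  have step : c * h ^ 2 * (Real.log (1 / U) / 2 - Real.log 2) - C * h ^ 2 ≤ (32 / γ + 2) * h ^ 2 := by
    have e1 := mul_le_mul_of_nonneg_left hlog (le_of_lt (mul_pos hc hh2pos))
    have e2 : 32 * h ^ 2 / γ + 2 * h ^ 2 = (32 / γ + 2) * h ^ 2 := by ring
    have e3 : 2 * U = 2 * h ^ 2 := by rw [hh2]
    linarith
  by_contra hcon
  push Not at hcon
  have := mul_lt_mul_of_pos_left hcon hh2pos
  linarith

/-- `1/U ≤ e^{a/U}` once `0 < U ≤ a²/4` (`1/U ≤ (a/2U)² ≤ (e^{a/2U})²`). [folklore] -/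
theorem one_div_le_exp_div {U a : ℝ} (hU : 0 < U) (ha : 0 ≤ a) (hUa : U ≤ a ^ 2 / 4) :
    1 / U ≤ Real.exp (a / U) := by
  have step2 : 1 / U ≤ (a / (2 * U)) ^ 2 := by
    rw [div_pow, div_le_div_iff₀ hU (by positivity)]
    nlinarith
  have step3 : (a / (2 * U)) ^ 2 ≤ Real.exp (a / U) := by
    have e1 : a / (2 * U) ≤ Real.exp (a / (2 * U)) := by
      linarith [Real.add_one_le_exp (a / (2 * U))]
    have e2 : 0 ≤ a / (2 * U) := by positivity
    calc (a / (2 * U)) ^ 2 ≤ Real.exp (a / (2 * U)) ^ 2 := pow_le_pow_left₀ e2 e1 2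
      _ = Real.exp (a / U) := by rw [sq, ← Real.exp_add]; congr 1; ring
  exact step2.trans step3

/-- **No finite-size threshold can be chosen before the temperature** (UNCONDITIONAL; supersedes the
conditional `twSourcedCondensation_false_frozenThreshold_of_gap/_of_freeGap`): the crux
`TwSourcedCondensation` with `∃ L₀` moved in front of `∀ U β μ` (so `L₀` may depend on
`μ₁, μ₂, U₀, a, c, C, h₀` only) is FALSE. Witness: interval `[-3,-1]`; given `L₀`, the torus `L = max(L₀,3)`
and a generic `μ ∈ [-3,-1]` off its finite free level set (gap `γ > 0`, `exists_mu_off_levels`); then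
`β = 1/U`, `h = √U` with `U = min(U₀, 1, h₀², a²/4, e^{-M-1})`, `M = 2(32/γ + 2 + C + c log 2)/c`: the
response is `≤ (32/γ + 2)h²` (`levelGap_obstruction`: exact free BdG pressure, `β`-uniform per-mode cap,
`G_U ≤ G_0 + 2U`) while the claimed floor is `≥ h²(c(½ log(1/U) - log 2) - C)`. In particular the
threshold frozen at ANY side `ℓ` (`∀ L ≥ ℓ`) is impossible, hypothesis-free. MESSAGE: `L₀(U,β,μ)` must
grow with `β` (`≳ √(c log β)` from this argument at generic `μ`; physically `L ≳ β`). [folklore] -/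
theorem twSourcedCondensation_false_uniformL0 :
    ¬ (∀ μ₁ μ₂ : ℝ, -4 < μ₁ → μ₁ ≤ μ₂ → μ₂ < 0 → ∃ U₀ a c C h₀ : ℝ, ∃ L₀ : ℕ, 0 < U₀ ∧ 0 < a ∧ 0 < c ∧
      0 < C ∧ 0 < h₀ ∧ ∀ U : ℝ, 0 < U → U ≤ U₀ → ∀ β : ℝ, 1 ≤ β → β ≤ Real.exp (a / U) →
      ∀ μ ∈ Set.Icc μ₁ μ₂, ∀ (L : ℕ) [NeZero L], L₀ ≤ L → ∀ h : ℝ, |h| ≤ h₀ →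
        c * h ^ 2 * Real.log (1 / (|h| + 1 / β)) - C * h ^ 2 ≤
          Real.log (partitionFn β (dWaveSourceTorus L U μ h)).re / (β * (L : ℝ) ^ 2) -
            Real.log (partitionFn β (dWaveSourceTorus L U μ 0)).re / (β * (L : ℝ) ^ 2)) := by
  intro H
  obtain ⟨U₀, a, c, C, h₀, L₀, hU₀, ha, hc, hC, hh₀, H⟩ :=
    H (-3) (-1) (by norm_num) (by norm_num) (by norm_num)
  set L : ℕ := max L₀ 3 with hLdef
  have hL3 : 3 ≤ L := le_max_right _ _
  have hL₀ : L₀ ≤ L := le_max_left _ _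
  haveI : NeZero L := ⟨by omega⟩
  obtain ⟨μ, hμ, γ, hγ, hgap⟩ := exists_mu_off_levels L (show (-3 : ℝ) < -1 by norm_num)
  set A : ℝ := 32 / γ + 2 with hA
  have hA0 : 0 ≤ A := by positivity
  have hlog2 : 0 < Real.log 2 := Real.log_pos one_lt_two
  set M : ℝ := 2 * (A + C + c * Real.log 2) / c with hM
  have hM0 : 0 ≤ M := by positivity
  set U : ℝ := min U₀ (min (min 1 (h₀ ^ 2)) (min (a ^ 2 / 4) (Real.exp (-M - 1)))) with hU
  have hUpos : 0 < U := by positivity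
  have hUU₀ : U ≤ U₀ := min_le_left _ _
  have hU1 : U ≤ 1 := (min_le_right _ _).trans ((min_le_left _ _).trans (min_le_left _ _))
  have hU2 : U ≤ h₀ ^ 2 := (min_le_right _ _).trans ((min_le_left _ _).trans (min_le_right _ _))
  have hU3 : U ≤ a ^ 2 / 4 := (min_le_right _ _).trans ((min_le_right _ _).trans (min_le_left _ _))
  have hU4 : U ≤ Real.exp (-M - 1) := (min_le_right _ _).trans ((min_le_right _ _).trans (min_le_right _ _))
  -- the admissible point `β = 1/U`, `h = √U`
  have hβ1 : 1 ≤ 1 / U := by rw [le_div_iff₀ hUpos, one_mul]; exact hU1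
  have hβexp : 1 / U ≤ Real.exp (a / U) := one_div_le_exp_div hUpos ha.le hU3
  have hhh₀ : |Real.sqrt U| ≤ h₀ := by
    rw [abs_of_nonneg (Real.sqrt_nonneg U), ← Real.sqrt_sq hh₀.le]
    exact Real.sqrt_le_sqrt hU2
  have key := H U hUpos hUU₀ (1 / U) hβ1 hβexp μ hμ L hL₀ (Real.sqrt U) hhh₀
  have core := levelGap_obstruction hL3 hγ hgap hUpos hU1 hc key
  -- but `log(1/U) ≥ M + 1`
  have hlogU : M + 1 ≤ Real.log (1 / U) := by
    have h2 : Real.log U ≤ -M - 1 := by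
      rw [← Real.log_exp (-M - 1)]; exact Real.log_le_log hUpos hU4
    rw [one_div, Real.log_inv]
    linarith
  have hc0 : c ≠ 0 := hc.ne'
  have hcM : c * M / 2 = A + C + c * Real.log 2 := by
    rw [hM]; field_simp
  have h1 : c * (M + 1) ≤ c * Real.log (1 / U) := mul_le_mul_of_nonneg_left hlogU hc.le
  linarith

/-- **Corollary: the frozen threshold is FALSE at every side `ℓ`, hypothesis-free.** [folklore] -/
theorem twSourcedCondensation_false_frozenThreshold (ℓ : ℕ) :
    ¬ (∀ μ₁ μ₂ : ℝ, -4 < μ₁ → μ₁ ≤ μ₂ → μ₂ < 0 → ∃ U₀ a c C h₀ : ℝ, 0 < U₀ ∧ 0 < a ∧ 0 < c ∧ 0 < C ∧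
      0 < h₀ ∧ ∀ U : ℝ, 0 < U → U ≤ U₀ → ∀ β : ℝ, 1 ≤ β → β ≤ Real.exp (a / U) →
      ∀ μ ∈ Set.Icc μ₁ μ₂, ∀ (L : ℕ) [NeZero L], ℓ ≤ L → ∀ h : ℝ, |h| ≤ h₀ →
        c * h ^ 2 * Real.log (1 / (|h| + 1 / β)) - C * h ^ 2 ≤
          Real.log (partitionFn β (dWaveSourceTorus L U μ h)).re / (β * (L : ℝ) ^ 2) -
            Real.log (partitionFn β (dWaveSourceTorus L U μ 0)).re / (β * (L : ℝ) ^ 2)) := by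
  intro H
  refine twSourcedCondensation_false_uniformL0 fun μ₁ μ₂ h1 h2 h3 => ?_
  obtain ⟨U₀, a, c, C, h₀, hU₀, ha, hc, hC, hh₀, H⟩ := H μ₁ μ₂ h1 h2 h3
  exact ⟨U₀, a, c, C, h₀, ℓ, hU₀, ha, hc, hC, hh₀, H⟩

end Summit.HubbardSuperconductivity.HubbardSuperconductivity.Theorems.TwSourcedCondensation.Negative
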